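import Literature.Analysis.FluidPDE.AncientMildWeak
import Literature.Analysis.FluidPDE.SolenoidalTruncation
import Literature.Analysis.UnboundedOperators.HeatKernelBoundedData
import HarnessLib

/-!
# Weak-* continuity in time of decaying bounded ancient families

Analysis/FluidPDE support file (all results proved) for the named fact
`Literature.Analysis.FluidPDE.knss_bound_C_over_r` (`SelfSimilarLiouville`; Koch–Nadirashvili–
Seregin–Šverák 2009, Theorem 5.3), on the path `KNSSLiouville` → `AncientMildPairing` →
`AncientMildWeak` → `KNSSLiouvilleBridge`: the bridge from the printed theorem to the
duality-form fact (`knss_bound_C_over_r_of_KNSS2009_of_modification`) is complete once every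
family `u` in the duality-form class with the decay `r‖u‖ ≤ C` is shown to admit a jointly
measurable modification. This file supplies the analytic input for that: the family is
**weak-* continuous in time**, i.e. `t ↦ ∫⟪u(t), θ⟫` is continuous on `(-∞, 0)` for *every*
test field `θ` (`continuousOn_integral_inner_of_cylRadius_decay`), not only for the
divergence-free ones given by the two-time identity (`AncientMildPairing`).

## The argument

Let `u(t)`, `t < 0`, be bounded, measurable, weakly divergence free, with continuous pairings
against divergence-free tests.
* (`continuousOn_integral_inner_laplacian_of_divFree`) Pairings with `ΔW`, `W ∈ C_c^∞(E; E)`, are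
  continuous: `ΔW = (ΔW - ∇div W) + ∇div W`, the first field is a divergence-free test field
  (`div Δ = Δ div`, `IsTestFunctionOn.laplacian_sub_gradient_divergence` — the weak clothing of
  `ΔW = ∇div W - curl curl W`, in every dimension) and the second pairs to zero.
* (`exists_test_integral_norm_laplacian_add_le`) **Approximate inverse Laplacian in `C_c^∞` with
  `L¹` error**: if the caloric extensions of a test field `θ'` decay, `‖e^{σΔ}θ'‖_{L¹} ≤ Kσ^{-1/2}`,
  then for every `ε` there is `W ∈ C_c^∞` with `‖ΔW + θ'‖_{L¹} ≤ ε`. Take the caloric potential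
  `V = 𝒰₁[χ(t/T)θ'](0) = ∫₀^{2T} χ(σ/T) e^{σΔ}θ' dσ` (`heatDuhamelBack`), which by the backward heat
  equation solves `ΔV = -θ' - r` with `r = ∫ T⁻¹χ'(σ/T) e^{σΔ}θ' dσ`, `‖r‖_{L¹} ≤ BKT^{-1/2}`
  (`integral_norm_heatDuhamelBack_timeDeriv_le`), and truncate, `W = η_R V`: the cut-off costs
  `(2nC₁/R)‖DV‖_{L¹} + (C₂/R²)‖V‖_{L¹}` since `V, DV ∈ L¹`.
* (`exists_test_fderiv_apply_eq_sub_translate`, `exists_integral_norm_heatExtension_fderiv_apply_le`)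
  A difference of translates `θ - θ(· - b) = ∂_bΞ`, `Ξ = ∫₀¹ θ(· - sb) ds ∈ C_c^∞`, has caloric
  decay: `e^{σΔ}∂_bΞ = ∂_b e^{σΔ}Ξ` and `‖∇e^{σΔ}Ξ‖_{L¹} ≤ Cσ^{-1/2}‖Ξ‖_{L¹}`
  (`Literature.Analysis.UnboundedOperators.eLpNorm_fderiv_heatExtension_le`, discharged in the
  tree). Hence `t ↦ ∫⟪u(t), θ - θ(· - b)⟫` is a uniform limit of continuous functions
  (`continuousOn_integral_inner_sub_translate`); the translate is invisible to spatial constants.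
* (`continuousOn_integral_inner_of_cylRadius_decay`, `ℝ³`) With the decay `r‖u(t,x)‖ ≤ C` the
  pairing with a translate `θ(· - Le₀)` far from the axis is uniformly small,
  `≤ C‖θ‖_{L¹}/(L - R₀)`, so `t ↦ ∫⟪u(t), θ⟫` itself is continuous: the decay pins the spatially
  constant ambiguity `b(t)` of KNSS 2009, §1 ("parasitic solutions").

## Mathlib / tree search

From the tree: the backward caloric Duhamel integral and its calculus (`FluidPDE/HeatDuhamelBack`:
`heatDuhamelBack_backward_heat`, `laplacian_heatDuhamelBack`, `fderiv_heatDuhamelBack`,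
`integrable_heatDuhamelBack`), the caloric extension and `‖∇e^{tΔ}f‖_p ≤ Ct^{-1/2}‖f‖_p`
(`UnboundedOperators/HeatKernelGradient`, `HeatKernelBoundedData`), the cut-off with its
`O(R⁻¹)`, `O(R⁻²)` derivative bounds (`WholeSpaceIBP`, `MildSolutionProofs`), the Leibniz rule
`laplacian_smul_apply`, `divergence_fderiv_apply`, `divergence_gradient`, smoothness of
parametric integrals (`SolenoidalTruncation`), the `L^∞`–`L¹` pairing lemmas
(`AncientMildPairing`). From Mathlib: `continuousOn_of_uniform_approx_of_continuousOn`,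
`contDiff_succ_iff_fderiv_apply`, `intervalIntegral.integral_eq_sub_of_hasDerivAt`,
`tendsto_rpow_neg_atTop`, `integral_sub_right_eq_self`.

## References

* G. Koch, N. Nadirashvili, G. Seregin, V. Šverák, *Liouville theorems for the Navier–Stokes
  equations and applications*, Acta Math. 203 (2009) 83–105 = arXiv:0709.3599, §1 p. 3
  (parasitic solutions `u(x,t) = b(t)`), Theorem 5.3 p. 10. [KochNadirashviliSereginSverak2009]
* P. G. Lemarié-Rieusset, *The Navier–Stokes problem in the 21st century*, CRC Press 2016,
  Prop. 4.3 (the Duhamel integral of the heat kernel), proof of Thm. 4.4 (`ΔF = ∇div F - curl curl F`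
  weakly). [LemarieRieusset2016]
-/

noncomputable section

open MeasureTheory Set Function Filter Topology TopologicalSpace InnerProductSpace
open scoped Laplacian RealInnerProductSpace NNReal ENNReal ContDiff

namespace Literature.Analysis.FluidPDE

variable {E : Type*} [NormedAddCommGroup E] [InnerProductSpace ℝ E] [FiniteDimensional ℝ E]
  [MeasurableSpace E] [BorelSpace E]

/-! ### The solenoidal part `ΔW - ∇ div W` of the Laplacian of a test field -/

section Solenoidal

omit [MeasurableSpace E] [BorelSpace E] in
/-- **`div ΔW = Δ div W`** for `W ∈ C³(E; E)` (`Δ = Σᵢ ∂ᵢ∂ᵢ` over an orthonormal frame and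
`div ∂ᵢ = ∂ᵢ div`, `divergence_fderiv_apply`, twice). [folklore] -/
theorem divergence_laplacian_eq_laplacian_divergence {W : E → E} (hW : ContDiff ℝ 3 W) (x : E) :
    VectorCalculus.divergence (Δ W) x = Δ (VectorCalculus.divergence W) x := by
  set b := stdOrthonormalBasis ℝ E
  have hW2 : ContDiff ℝ 2 W := hW.of_le (by norm_num)
  have hDi : ∀ w : E, ContDiff ℝ 2 (fun y => fderiv ℝ W y w) := fun w =>
    (hW.fderiv_right (m := 2) (by norm_num)).clm_apply contDiff_const
  have hDii : ∀ w : E, ContDiff ℝ 1 (fun y => fderiv ℝ (fun z => fderiv ℝ W z w) y w) := fun w =>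
    ((hDi w).fderiv_right (m := 1) (by norm_num)).clm_apply contDiff_const
  have hΔ : Δ W = fun y => ∑ i, fderiv ℝ (fun z => fderiv ℝ W z (b i)) y (b i) :=
    funext fun y => laplacian_eq_sum_fderiv_fderiv_normed b hW2 y
  have hdiv2 : ContDiff ℝ 2 (VectorCalculus.divergence W) := contDiff_divergence (n := 2) hW
  rw [hΔ, divergence_eq_traceCLM,
    fderiv_fun_sum fun i _ => ((hDii (b i)).differentiable one_ne_zero x), map_sum,
    laplacian_eq_sum_fderiv_fderiv_normed b hdiv2 x]
  refine Finset.sum_congr rfl fun i _ => ?_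
  rw [← divergence_eq_traceCLM, divergence_fderiv_apply (hDi (b i)) x (b i)]
  have hfun : (VectorCalculus.divergence fun y => fderiv ℝ W y (b i)) =
      fun y => fderiv ℝ (VectorCalculus.divergence W) y (b i) :=
    funext fun y => divergence_fderiv_apply hW2 y (b i)
  rw [hfun]

omit [MeasurableSpace E] [BorelSpace E] in
/-- The slicewise Laplacian of a test field on `E` is a test field (`Δ = Σᵢ ∂ᵢ∂ᵢ`). [folklore] -/
theorem _root_.Literature.Analysis.FunctionSpaces.IsTestFunctionOn.laplacian_top {W : E → E}
    (hW : FunctionSpaces.IsTestFunctionOn (⊤ : Opens E) W) :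
    FunctionSpaces.IsTestFunctionOn (⊤ : Opens E) (Δ W) := by
  set b := stdOrthonormalBasis ℝ E
  have hW2 : ContDiff ℝ 2 W := contDiff_infty.1 hW.contDiff 2
  have hΔ : Δ W = fun y => ∑ i, fderiv ℝ (fun z => fderiv ℝ W z (b i)) y (b i) :=
    funext fun y => laplacian_eq_sum_fderiv_fderiv_normed b hW2 y
  refine ⟨?_, ?_, by simp⟩
  · rw [hΔ]
    exact ContDiff.sum fun i _ => ((hW.fderiv_apply_const (b i)).fderiv_apply_const (b i)).contDiff
  · exact HasCompactSupport.intro hW.hasCompactSupport fun x hx =>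
      laplacian_eq_zero_of_notMem_tsupport hx

omit [MeasurableSpace E] [BorelSpace E] in
/-- The gradient of the divergence of a test field on `E` is a test field. [folklore] -/
theorem _root_.Literature.Analysis.FunctionSpaces.IsTestFunctionOn.gradient_divergence_top {W : E → E}
    (hW : FunctionSpaces.IsTestFunctionOn (⊤ : Opens E) W) :
    FunctionSpaces.IsTestFunctionOn (⊤ : Opens E) (gradient (VectorCalculus.divergence W)) := by
  have hdiv : ContDiff ℝ (⊤ : ℕ∞) (VectorCalculus.divergence W) := by
    refine contDiff_infty.2 fun n => ?_
    exact contDiff_divergence (n := n) (contDiff_infty.1 hW.contDiff _)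
  refine ⟨?_, ?_, by simp⟩
  · refine contDiff_infty.2 fun n => ?_
    exact (InnerProductSpace.toDual ℝ E).symm.contDiff.comp
      (hdiv.fderiv_right (m := n) (by exact_mod_cast le_top))
  · have hsupp : HasCompactSupport (VectorCalculus.divergence W) := by
      refine HasCompactSupport.intro hW.hasCompactSupport fun x hx => ?_
      have h0 : fderiv ℝ W x = 0 := fderiv_of_notMem_tsupport ℝ hx
      simp [VectorCalculus.divergence, h0]
    exact (hsupp.fderiv (𝕜 := ℝ)).comp_left (g := (InnerProductSpace.toDual ℝ E).symm) (map_zero _)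

omit [MeasurableSpace E] [BorelSpace E] in
/-- **The solenoidal part of the Laplacian of a test field**, `ΔW - ∇ div W`, is a smooth
compactly supported divergence-free field (`div (ΔW - ∇div W) = Δ div W - Δ div W = 0`; the
classical identity `ΔW = ∇ div W - curl curl W` in weak clothing, valid in every dimension).
[folklore] -/
theorem _root_.Literature.Analysis.FunctionSpaces.IsTestFunctionOn.laplacian_sub_gradient_divergence {W : E → E}
    (hW : FunctionSpaces.IsTestFunctionOn (⊤ : Opens E) W) :
    FunctionSpaces.IsTestFunctionOn (⊤ : Opens E) (fun x => Δ W x - gradient (VectorCalculus.divergence W) x) ∧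
      VectorCalculus.IsDivFree (fun x => Δ W x - gradient (VectorCalculus.divergence W) x) := by
  have h1 := hW.laplacian_top
  have h2 := hW.gradient_divergence_top
  refine ⟨⟨h1.contDiff.sub h2.contDiff, h1.hasCompactSupport.sub h2.hasCompactSupport, by simp⟩,
    fun x => ?_⟩
  have hW3 : ContDiff ℝ 3 W := contDiff_infty.1 hW.contDiff 3
  have hd1 : DifferentiableAt ℝ (Δ W) x := (h1.contDiff.differentiable (by simp)) x
  have hd2 : DifferentiableAt ℝ (gradient (VectorCalculus.divergence W)) x :=
    (h2.contDiff.differentiable (by simp)) x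
  rw [divergence_sub_apply hd1 hd2, divergence_gradient (contDiff_divergence (n := 2) hW3),
    divergence_laplacian_eq_laplacian_divergence hW3, sub_self]

/-- **Pairing a weakly divergence-free field with `ΔW`** only sees the solenoidal part:
`∫ ⟪w, ΔW⟫ = ∫ ⟪w, ΔW - ∇ div W⟫` for `w ∈ L¹_loc` weakly divergence free and `W` a test
field (the gradient part pairs to zero by definition of weak divergence-freeness, tested
with `div W ∈ C_c^∞`). [folklore] -/
theorem IsWeaklyDivFree.integral_inner_laplacian_eq {w W : E → E} (hdiv : IsWeaklyDivFree w)
    (hwl : LocallyIntegrable w (volume : Measure E))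
    (hW : FunctionSpaces.IsTestFunctionOn (⊤ : Opens E) W) :
    ∫ x, ⟪w x, Δ W x⟫ = ∫ x, ⟪w x, Δ W x - gradient (VectorCalculus.divergence W) x⟫ := by
  have h1 := hW.laplacian_top
  have h2 := hW.gradient_divergence_top
  have hdivW : FunctionSpaces.IsTestFunctionOn (⊤ : Opens E) (VectorCalculus.divergence W) := by
    refine ⟨contDiff_infty.2 fun n => contDiff_divergence (n := n) (contDiff_infty.1 hW.contDiff _),
      ?_, by simp⟩
    refine HasCompactSupport.intro hW.hasCompactSupport fun x hx => ?_
    have h0 : fderiv ℝ W x = 0 := fderiv_of_notMem_tsupport ℝ hx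
    simp [VectorCalculus.divergence, h0]
  have e0 : ∫ x, ⟪w x, gradient (VectorCalculus.divergence W) x⟫ = 0 := hdiv _ hdivW
  have i1 : Integrable (fun x => ⟪w x, Δ W x⟫) volume :=
    integrable_inner_of_locallyIntegrable_of_hasCompactSupport hwl h1.contDiff.continuous
      h1.hasCompactSupport
  have i2 : Integrable (fun x => ⟪w x, gradient (VectorCalculus.divergence W) x⟫) volume :=
    integrable_inner_of_locallyIntegrable_of_hasCompactSupport hwl h2.contDiff.continuous
      h2.hasCompactSupport
  simp_rw [inner_sub_right]
  rw [integral_sub i1 i2, e0, sub_zero]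

end Solenoidal

/-! ### The backward caloric Duhamel integral: smoothness, an `L¹` bound -/

section Duhamel

variable {F : Type*} [NormedAddCommGroup F] [NormedSpace ℝ F] [CompleteSpace F]
variable {ν : ℝ}

/-- `𝒰[Θ](s)` is `Cⁿ` in `x` for every `n` (all derivatives fall on the data,
`fderiv_heatDuhamelBack_apply`, by induction on `n`). [folklore] -/
theorem IsSpaceTimeTestOn.contDiff_heatDuhamelBack_nat (hν : 0 < ν) (s : ℝ) (n : ℕ) :
    ∀ {Θ : ℝ → E → F}, IsSpaceTimeTestOn (⊤ : Opens (ℝ × E)) Θ →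
      ContDiff ℝ n (heatDuhamelBack ν Θ s) := by
  induction n with
  | zero =>
    intro Θ hΘ
    exact contDiff_zero.2 (hΘ.continuous_heatDuhamelBack_space hν s)
  | succ n ih =>
    intro Θ hΘ
    rw [show ((n + 1 : ℕ) : WithTop ℕ∞) = (n : WithTop ℕ∞) + 1 from by push_cast; rfl,
      contDiff_succ_iff_fderiv_apply]
    refine ⟨hΘ.differentiable_heatDuhamelBack hν s, fun h => absurd h (by simp), fun v => ?_⟩
    have heq : (fun x => fderiv ℝ (heatDuhamelBack ν Θ s) x v) =
        heatDuhamelBack ν (fun t y => fderiv ℝ (Θ t) y v) s :=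
      funext fun x => hΘ.fderiv_heatDuhamelBack_apply hν s x v
    rw [heq]
    exact ih (hΘ.fderiv_apply_top v)

/-- `𝒰[Θ](s)` is smooth in `x`. [folklore] -/
theorem IsSpaceTimeTestOn.contDiff_heatDuhamelBack {Θ : ℝ → E → F}
    (hΘ : IsSpaceTimeTestOn (⊤ : Opens (ℝ × E)) Θ) (hν : 0 < ν) (s : ℝ) :
    ContDiff ℝ (⊤ : ℕ∞) (heatDuhamelBack ν Θ s) :=
  contDiff_infty.2 fun n => hΘ.contDiff_heatDuhamelBack_nat hν s n

/-- **Integrability of the Duhamel integrand on `E × (0, ∞)`** for a space–time test field: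
`(x, σ) ↦ (e^{νσΔ}Θ(s + σ))(x)` is integrable for the product of Lebesgue measure on `E` and
Lebesgue measure on `(0, ∞)` (bounded slice `L¹` norms on the bounded time support). [folklore] -/
theorem IsSpaceTimeTestOn.integrable_duhamelIntegrand_prod {Θ : ℝ → E → F}
    (hΘ : IsSpaceTimeTestOn (⊤ : Opens (ℝ × E)) Θ) (hν : 0 < ν) (s : ℝ) :
    Integrable (fun q : E × ℝ => UnboundedOperators.heatExtension (Θ (s + q.2)) (ν * q.2) q.1)
      ((volume : Measure E).prod (volume.restrict (Ioi (0 : ℝ)))) := by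
  obtain ⟨M₁, hM₁0, hM₁⟩ := hΘ.exists_integral_norm_slice_le
  obtain ⟨a, b, hab⟩ := hΘ.exists_time_support
  set L : ℝ := max (b - s) 0 with hL_def
  set Φ : E × ℝ → F := fun q => UnboundedOperators.heatExtension (Θ (s + q.2)) (ν * q.2) q.1 with hΦ_def
  have hmeasΦ : AEStronglyMeasurable Φ ((volume : Measure E).prod (volume.restrict (Ioi (0 : ℝ)))) := by
    have hc : ContinuousOn Φ (univ ×ˢ Ioi 0) := by
      have hcq : Continuous fun q : E × ℝ => ((s, q.2, q.1) : ℝ × ℝ × E) := by fun_prop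
      have h := ContinuousOn.comp (g := fun p : ℝ × ℝ × E =>
          UnboundedOperators.heatExtension (Θ (p.1 + p.2.1)) (ν * p.2.1) p.2.2)
        (f := fun q : E × ℝ => ((s, q.2, q.1) : ℝ × ℝ × E)) (s := univ ×ˢ Ioi 0)
        (hΘ.continuousOn_duhamelIntegrand hν) hcq.continuousOn (fun q hq => show 0 < q.2 from hq.2)
      simpa only [Function.comp_def] using h
    have h := hc.aestronglyMeasurable (μ := (volume : Measure E).prod (volume : Measure ℝ))
      (MeasurableSet.univ.prod measurableSet_Ioi)
    have hμ : ((volume : Measure E).prod (volume : Measure ℝ)).restrict (univ ×ˢ Ioi 0) =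
        (volume : Measure E).prod (volume.restrict (Ioi (0 : ℝ))) := by
      rw [← Measure.prod_restrict, Measure.restrict_univ]
    rwa [hμ] at h
  rw [integrable_prod_iff' hmeasΦ]
  constructor
  · refine (ae_restrict_iff' measurableSet_Ioi).2 (Eventually.of_forall fun σ hσ => ?_)
    exact (integral_norm_heatExtension_le (hΘ.contDiff_slice (s + σ)).continuous
      (hΘ.hasCompactSupport_slice (s + σ)) (mul_pos hν hσ)).1
  · have hmeas1 : AEStronglyMeasurable (fun σ => ∫ x, ‖Φ (x, σ)‖)
        (volume.restrict (Ioi (0 : ℝ))) :=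
      hmeasΦ.norm.prod_swap.integral_prod_right'
    have hbd : ∀ᵐ σ ∂(volume.restrict (Ioi (0 : ℝ))), ‖∫ x, ‖Φ (x, σ)‖‖ ≤
        (Ioc (0 : ℝ) L).indicator (fun _ => M₁) σ := by
      refine (ae_restrict_iff' measurableSet_Ioi).2 (Eventually.of_forall fun σ hσ => ?_)
      rw [Real.norm_of_nonneg (integral_nonneg fun _ => norm_nonneg _)]
      by_cases hσL : σ ≤ L
      · rw [indicator_of_mem (show σ ∈ Ioc (0 : ℝ) L from ⟨hσ, hσL⟩)]
        exact (integral_norm_heatExtension_le (hΘ.contDiff_slice (s + σ)).continuous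
          (hΘ.hasCompactSupport_slice (s + σ)) (mul_pos hν hσ)).2.trans (hM₁ (s + σ))
      · rw [indicator_of_notMem (fun h => hσL h.2)]
        have h0 : ∀ x, Φ (x, σ) = 0 := fun x =>
          duhamelIntegrand_eq_zero hab ((le_max_left _ _).trans_lt (not_le.1 hσL)) x
        simp [h0]
    have hinti : Integrable ((Ioc (0 : ℝ) L).indicator fun _ => M₁) (volume.restrict (Ioi 0)) := by
      refine Integrable.integrableOn ?_
      refine (integrable_indicator_iff measurableSet_Ioc).2 ?_
      haveI : IsFiniteMeasure (volume.restrict (Ioc (0 : ℝ) L)) :=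
        isFiniteMeasure_restrict.2 measure_Ioc_lt_top.ne
      exact integrable_const M₁
    exact hinti.mono' hmeas1 hbd

/-- **`L¹` bound for the backward Duhamel integral by the time integral of slice norms**:
if `∫ ‖e^{νσΔ}Θ(s + σ)‖ dx ≤ g(σ)` for every `σ > 0` with `g` integrable on `(0, ∞)`, then
`∫ ‖𝒰[Θ](s)‖ dx ≤ ∫₀^∞ g(σ) dσ` (norm of the integral, Tonelli). [folklore] -/
theorem IsSpaceTimeTestOn.integral_norm_heatDuhamelBack_le_of_slice {Θ : ℝ → E → F}
    (hΘ : IsSpaceTimeTestOn (⊤ : Opens (ℝ × E)) Θ) (hν : 0 < ν) (s : ℝ) {g : ℝ → ℝ}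
    (hg : IntegrableOn g (Ioi 0) volume)
    (hle : ∀ σ, 0 < σ → ∫ x, ‖UnboundedOperators.heatExtension (Θ (s + σ)) (ν * σ) x‖ ≤ g σ) :
    ∫ x, ‖heatDuhamelBack ν Θ s x‖ ≤ ∫ σ in Ioi 0, g σ := by
  have hint := hΘ.integrable_duhamelIntegrand_prod hν s
  set Φ : E × ℝ → F := fun q => UnboundedOperators.heatExtension (Θ (s + q.2)) (ν * q.2) q.1 with hΦ_def
  have h1 : ∫ x, ‖heatDuhamelBack ν Θ s x‖ ≤ ∫ x, ∫ σ in Ioi 0, ‖Φ (x, σ)‖ := by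
    refine integral_mono_of_nonneg (Eventually.of_forall fun _ => norm_nonneg _)
      hint.norm.integral_prod_left (Eventually.of_forall fun x => ?_)
    show ‖heatDuhamelBack ν Θ s x‖ ≤ ∫ σ in Ioi 0, ‖Φ (x, σ)‖
    rw [heatDuhamelBack_apply]
    exact norm_integral_le_integral_norm _
  have h2 : ∫ x, ∫ σ in Ioi 0, ‖Φ (x, σ)‖ = ∫ σ in Ioi 0, ∫ x, ‖Φ (x, σ)‖ := by
    have hint' : Integrable (uncurry fun (x : E) (σ : ℝ) => ‖Φ (x, σ)‖)
        ((volume : Measure E).prod (volume.restrict (Ioi (0 : ℝ)))) := hint.norm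
    exact integral_integral_swap hint'
  have h3 : ∫ σ in Ioi 0, ∫ x, ‖Φ (x, σ)‖ ≤ ∫ σ in Ioi 0, g σ := by
    refine setIntegral_mono_on hint.norm.integral_prod_right hg measurableSet_Ioi fun σ hσ => ?_
    exact hle σ hσ
  exact h1.trans (h2.le.trans h3)

end Duhamel

/-! ### Separated space–time test fields `ζ(t) θ(x)` and the caloric potential `𝒰[ζθ](0)` -/

section Potential

variable {F : Type*} [NormedAddCommGroup F] [NormedSpace ℝ F]

omit [MeasurableSpace E] [BorelSpace E] [InnerProductSpace ℝ E] [FiniteDimensional ℝ E] in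
/-- A separated field `(t, x) ↦ ζ(t) θ(x)` with `ζ ∈ C_c^∞(ℝ)` and `θ` a test field on `E` is a
space–time test field on `ℝ × E`. [folklore] -/
theorem isSpaceTimeTestOn_time_smul [NormedSpace ℝ E] {ζ : ℝ → ℝ} (hζ : ContDiff ℝ (⊤ : ℕ∞) ζ)
    (hζc : HasCompactSupport ζ) {θ : E → F} (hθ : FunctionSpaces.IsTestFunctionOn (⊤ : Opens E) θ) :
    IsSpaceTimeTestOn (⊤ : Opens (ℝ × E)) (fun t x => ζ t • θ x) := by
  refine ⟨?_, ?_, by simp⟩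
  · exact (hζ.comp contDiff_fst).smul (hθ.contDiff.comp contDiff_snd)
  · -- the support lies in `tsupport ζ × tsupport θ`
    refine HasCompactSupport.intro (hζc.prod hθ.hasCompactSupport) fun p hp => ?_
    obtain ⟨t, x⟩ := p
    simp only [uncurry_apply_pair]
    rw [mem_prod, not_and_or] at hp
    rcases hp with h | h
    · rw [image_eq_zero_of_notMem_tsupport h, zero_smul]
    · rw [image_eq_zero_of_notMem_tsupport h, smul_zero]

omit [MeasurableSpace E] [BorelSpace E] [InnerProductSpace ℝ E] [FiniteDimensional ℝ E] in
/-- Time derivative of a separated field: `∂ₜ(ζ(t) θ(x)) = ζ'(t) θ(x)`. [folklore] -/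
theorem timeDeriv_time_smul [NormedSpace ℝ E] {ζ : ℝ → ℝ} (hζ : Differentiable ℝ ζ) (θ : E → F) (t : ℝ) (x : E) :
    timeDeriv (fun t x => ζ t • θ x) t x = deriv ζ t • θ x := by
  rw [timeDeriv_apply]
  exact ((hζ t).hasDerivAt.smul_const (θ x)).deriv

/-- **The caloric potential solves Poisson's equation up to a caloric remainder.** For a
space–time test field `Θ` and `0 < ν`,
`ν Δ(𝒰[Θ](s)) = -Θ(s) - 𝒰[∂ₜΘ](s)` pointwise (`Δ𝒰[Θ] = 𝒰[ΔΘ]` and the backward heat equation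
`𝒰[∂ₜΘ] + ν𝒰[ΔΘ] = -Θ`). With `Θ(t, x) = χ(t/T) θ(x)`, `χ = 1` near `0`, this says that
`V = 𝒰[Θ](0)` solves `νΔV = -θ - r` with the remainder `r = 𝒰[∂ₜΘ](0)` built from the caloric
extensions `e^{νσΔ}θ`, `σ ∈ [T, 2T]`, only. [folklore] -/
theorem IsSpaceTimeTestOn.smul_laplacian_heatDuhamelBack [CompleteSpace F] {Θ : ℝ → E → F}
    (hΘ : IsSpaceTimeTestOn (⊤ : Opens (ℝ × E)) Θ) {ν : ℝ} (hν : 0 < ν) (s : ℝ) (x : E) :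
    ν • Δ (heatDuhamelBack ν Θ s) x = -Θ s x - heatDuhamelBack ν (timeDeriv Θ) s x := by
  rw [hΘ.laplacian_heatDuhamelBack hν s x, eq_sub_iff_add_eq, add_comm]
  exact hΘ.heatDuhamelBack_backward_heat hν s x

variable [CompleteSpace F]

/-- **`L¹` bound for the caloric remainder.** Let `θ` be a test field on `E` whose caloric
extensions decay in `L¹`, `∫ ‖e^{σΔ}θ‖ ≤ K σ^{-1/2}` for `σ ≥ 1`, let `χ` be the canonical bump
(`= 1` on `[-1, 1]`, supported in `[-2, 2]`) with `|χ'| ≤ B`, and `T ≥ 1`. Then the remainder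
`r = 𝒰₁[∂ₜ(χ(t/T)θ)](0) = ∫_T^{2T} T⁻¹χ'(σ/T) e^{σΔ}θ dσ` satisfies `∫ ‖r‖ ≤ B K T^{-1/2}`
(only the caloric extensions at times `σ ∈ [T, 2T]` enter). [folklore] -/
theorem integral_norm_heatDuhamelBack_timeDeriv_le {θ : E → F}
    (hθ : FunctionSpaces.IsTestFunctionOn (⊤ : Opens E) θ) {K : ℝ}
    (hdecay : ∀ σ : ℝ, 1 ≤ σ → ∫ x, ‖UnboundedOperators.heatExtension θ σ x‖ ≤ K * σ ^ (-(1 / 2 : ℝ)))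
    {B : ℝ} (hB : ∀ t, |deriv (FunctionSpaces.dyadicCutoff ℝ) t| ≤ B) {T : ℝ} (hT : 1 ≤ T) :
    ∫ x, ‖heatDuhamelBack 1 (timeDeriv fun t x => (FunctionSpaces.dyadicCutoff ℝ) (t / T) • θ x) 0 x‖ ≤
      B * K * T ^ (-(1 / 2 : ℝ)) := by
  set χ : ℝ → ℝ := ⇑(FunctionSpaces.dyadicCutoff ℝ) with hχ_def
  have hT0 : 0 < T := one_pos.trans_le hT
  have hK0 : 0 ≤ K := by
    have h := hdecay 1 le_rfl
    rw [Real.one_rpow, mul_one] at h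
    exact (integral_nonneg fun _ => norm_nonneg _).trans h
  have hB0 : 0 ≤ B := (abs_nonneg _).trans (hB 0)
  -- the time profile `ζ = χ(·/T)` and its derivative
  set ζ : ℝ → ℝ := fun t => χ (t / T) with hζ_def
  have hχs : ContDiff ℝ (⊤ : ℕ∞) χ := (FunctionSpaces.dyadicCutoff ℝ).contDiff
  have hζs : ContDiff ℝ (⊤ : ℕ∞) ζ := hχs.comp (contDiff_id.div_const T)
  have hζd : Differentiable ℝ ζ := hζs.differentiable (by simp)
  have hζ' : ∀ t, deriv ζ t = T⁻¹ * deriv χ (t / T) := fun t => by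
    have h := ((hχs.differentiable (by simp)) (t / T)).hasDerivAt.comp t
      ((hasDerivAt_id t).div_const T)
    have heq : (fun s => χ (s / T)) = χ ∘ fun x => id x / T := rfl
    rw [hζ_def, heq, h.deriv]
    ring
  -- `χ' (t/T) = 0` off `[T, 2T]` for `t > 0`
  have hχ'zero : ∀ t, 0 < t → t ∉ Icc T (2 * T) → deriv χ (t / T) = 0 := by
    intro t ht htI
    rcases not_and_or.1 (fun h => htI h) with h1 | h2
    · -- `t / T < 1`: `χ = 1` near `t / T`
      have hlt : t / T < 1 := by rw [div_lt_one hT0]; exact not_le.1 h1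
      have hev : χ =ᶠ[𝓝 (t / T)] fun _ => (1 : ℝ) := by
        filter_upwards [(isOpen_lt continuous_norm continuous_const).mem_nhds
          (show ‖t / T‖ < 1 from by rw [Real.norm_of_nonneg (div_nonneg ht.le hT0.le)]; exact hlt)]
          with y hy
        exact FunctionSpaces.dyadicCutoff_apply_of_norm_le_one hy.le
      rw [hev.deriv_eq, deriv_const]
    · -- `2 < t / T`: `χ = 0` near `t / T`
      have hgt : 2 < t / T := by rw [lt_div_iff₀ hT0]; linarith [not_le.1 h2]
      have hev : χ =ᶠ[𝓝 (t / T)] fun _ => (0 : ℝ) := by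
        filter_upwards [(isOpen_lt continuous_const continuous_norm).mem_nhds
          (show (2 : ℝ) < ‖t / T‖ from by
            rw [Real.norm_of_nonneg (div_nonneg ht.le hT0.le)]; exact hgt)] with y hy
        exact FunctionSpaces.dyadicCutoff_apply_of_two_le_norm hy.le
      rw [hev.deriv_eq, deriv_const]
  -- the space–time field and its time derivative
  have hζc : HasCompactSupport ζ := by
    refine HasCompactSupport.intro (isCompact_Icc : IsCompact (Icc (-(2 * T)) (2 * T))) fun t ht => ?_
    show χ (t / T) = 0
    apply FunctionSpaces.dyadicCutoff_apply_of_two_le_norm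
    rw [Real.norm_eq_abs, abs_div, abs_of_pos hT0, le_div_iff₀ hT0]
    rcases not_and_or.1 (fun h => ht (mem_Icc.2 h)) with h | h
    · have h' : t < -(2 * T) := not_le.1 h
      rw [abs_of_neg (by linarith)]
      linarith
    · have h' : 2 * T < t := not_le.1 h
      rw [abs_of_pos (by linarith)]
      linarith
  have hΘ : IsSpaceTimeTestOn (⊤ : Opens (ℝ × E)) (fun t x => ζ t • θ x) :=
    isSpaceTimeTestOn_time_smul hζs hζc hθ
  have hΘ' : IsSpaceTimeTestOn (⊤ : Opens (ℝ × E)) (timeDeriv fun t x => ζ t • θ x) := hΘ.timeDeriv_top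
  -- slice norms of the Duhamel integrand of `∂ₜΘ` at base time `0`
  have hslice : ∀ σ, 0 < σ →
      ∫ x, ‖UnboundedOperators.heatExtension ((timeDeriv fun t x => ζ t • θ x) (0 + σ)) (1 * σ) x‖ =
        |T⁻¹ * deriv χ (σ / T)| * ∫ x, ‖UnboundedOperators.heatExtension θ σ x‖ := by
    intro σ hσ
    have hfun : (timeDeriv fun t x => ζ t • θ x) (0 + σ) = fun x => (T⁻¹ * deriv χ (σ / T)) • θ x := by
      funext x
      rw [zero_add, timeDeriv_time_smul hζd, hζ' σ]
    rw [hfun, one_mul]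
    simp_rw [UnboundedOperators.heatExtension_const_smul, norm_smul, integral_const_mul, Real.norm_eq_abs]
  -- the majorant
  set g : ℝ → ℝ := (Icc T (2 * T)).indicator fun _ => T⁻¹ * B * K * T ^ (-(1 / 2 : ℝ)) with hg_def
  have hg : IntegrableOn g (Ioi 0) volume := by
    refine Integrable.integrableOn ?_
    refine (integrable_indicator_iff measurableSet_Icc).2 ?_
    haveI : IsFiniteMeasure (volume.restrict (Icc T (2 * T))) :=
      isFiniteMeasure_restrict.2 measure_Icc_lt_top.ne
    exact integrable_const _
  have hle : ∀ σ, 0 < σ →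
      ∫ x, ‖UnboundedOperators.heatExtension ((timeDeriv fun t x => ζ t • θ x) (0 + σ)) (1 * σ) x‖ ≤ g σ := by
    intro σ hσ
    rw [hslice σ hσ]
    by_cases hI : σ ∈ Icc T (2 * T)
    · rw [hg_def, indicator_of_mem hI]
      have hσ1 : 1 ≤ σ := hT.trans hI.1
      have hσT : σ ^ (-(1 / 2 : ℝ)) ≤ T ^ (-(1 / 2 : ℝ)) :=
        Real.rpow_le_rpow_of_nonpos hT0 hI.1 (by norm_num)
      calc |T⁻¹ * deriv χ (σ / T)| * ∫ x, ‖UnboundedOperators.heatExtension θ σ x‖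
          ≤ (T⁻¹ * B) * (K * σ ^ (-(1 / 2 : ℝ))) := by
            refine mul_le_mul ?_ (hdecay σ hσ1) (integral_nonneg fun _ => norm_nonneg _)
              (by positivity)
            rw [abs_mul, abs_of_pos (inv_pos.2 hT0)]
            exact mul_le_mul_of_nonneg_left (hB _) (inv_pos.2 hT0).le
        _ ≤ (T⁻¹ * B) * (K * T ^ (-(1 / 2 : ℝ))) := by
            refine mul_le_mul_of_nonneg_left (mul_le_mul_of_nonneg_left hσT hK0) (by positivity)
        _ = T⁻¹ * B * K * T ^ (-(1 / 2 : ℝ)) := by ring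
    · rw [hg_def, indicator_of_notMem hI, hχ'zero σ hσ hI]
      simp
  have key := hΘ'.integral_norm_heatDuhamelBack_le_of_slice one_pos 0 hg hle
  have hval : ∫ σ in Ioi 0, g σ = B * K * T ^ (-(1 / 2 : ℝ)) := by
    rw [hg_def, setIntegral_indicator measurableSet_Icc,
      show Ioi (0 : ℝ) ∩ Icc T (2 * T) = Icc T (2 * T) from
        inter_eq_right.2 fun σ hσ => hT0.trans_le hσ.1,
      setIntegral_const, Real.volume_real_Icc_of_le (by linarith), smul_eq_mul]
    field_simp
    ring
  rw [hval] at key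
  exact key

/-- The time profile `ζ_T = χ(·/T)` (`χ` the canonical bump) is smooth, compactly supported, and
equals `1` at `0`. [folklore] -/
theorem dyadic_timeProfile {T : ℝ} (hT : 0 < T) :
    ContDiff ℝ (⊤ : ℕ∞) (fun t : ℝ => (FunctionSpaces.dyadicCutoff ℝ) (t / T)) ∧
      HasCompactSupport (fun t : ℝ => (FunctionSpaces.dyadicCutoff ℝ) (t / T)) ∧
      (FunctionSpaces.dyadicCutoff ℝ) ((0 : ℝ) / T) = 1 := by
  refine ⟨(FunctionSpaces.dyadicCutoff ℝ).contDiff.comp (contDiff_id.div_const T), ?_, ?_⟩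
  · refine HasCompactSupport.intro (isCompact_Icc : IsCompact (Icc (-(2 * T)) (2 * T))) fun t ht => ?_
    apply FunctionSpaces.dyadicCutoff_apply_of_two_le_norm
    rw [Real.norm_eq_abs, abs_div, abs_of_pos hT, le_div_iff₀ hT]
    rcases not_and_or.1 (fun h => ht (mem_Icc.2 h)) with h | h
    · have h' : t < -(2 * T) := not_le.1 h
      rw [abs_of_neg (by linarith)]
      linarith
    · have h' : 2 * T < t := not_le.1 h
      rw [abs_of_pos (by linarith)]
      linarith
  · rw [zero_div]
    exact FunctionSpaces.dyadicCutoff_apply_of_norm_le_one (by simp)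

omit [MeasurableSpace E] [BorelSpace E] in
/-- Norm bound for the cross term of the Leibniz rule: `‖2 Σᵢ (∂ᵢη) ∂ᵢV‖ ≤ 2 n ‖Dη‖ ‖DV‖` over
an orthonormal frame of `n` vectors. [folklore] -/
theorem norm_two_smul_sum_fderiv_smul_fderiv_le {F' : Type*} [NormedAddCommGroup F']
    [NormedSpace ℝ F'] {η : E → ℝ} {V : E → F'} (x : E) :
    ‖(2 : ℝ) • ∑ i, (fderiv ℝ η x (stdOrthonormalBasis ℝ E i)) •
        fderiv ℝ V x (stdOrthonormalBasis ℝ E i)‖ ≤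
      2 * (Module.finrank ℝ E) * (‖fderiv ℝ η x‖ * ‖fderiv ℝ V x‖) := by
  set b := stdOrthonormalBasis ℝ E
  have hb : ∀ i, ‖b i‖ = 1 := fun i => b.orthonormal.1 i
  rw [norm_smul, Real.norm_two, mul_assoc]
  refine mul_le_mul_of_nonneg_left ?_ zero_le_two
  calc ‖∑ i, (fderiv ℝ η x (b i)) • fderiv ℝ V x (b i)‖
      ≤ ∑ i, ‖(fderiv ℝ η x (b i)) • fderiv ℝ V x (b i)‖ := norm_sum_le _ _
    _ ≤ ∑ _i : Fin (Module.finrank ℝ E), ‖fderiv ℝ η x‖ * ‖fderiv ℝ V x‖ := by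
        refine Finset.sum_le_sum fun i _ => ?_
        rw [norm_smul]
        refine mul_le_mul ?_ ?_ (norm_nonneg _) (norm_nonneg _)
        · simpa [hb i] using (fderiv ℝ η x).le_opNorm (b i)
        · simpa [hb i] using (fderiv ℝ V x).le_opNorm (b i)
    _ = (Module.finrank ℝ E) * (‖fderiv ℝ η x‖ * ‖fderiv ℝ V x‖) := by
        rw [Finset.sum_const, Finset.card_univ, Fintype.card_fin, nsmul_eq_mul]

/-- **Approximate inverse Laplacian in `C_c^∞` with `L¹` error.** Let `θ` be a smooth compactly
supported field on `E` whose caloric extensions decay in `L¹` like `σ^{-1/2}`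
(`∫ ‖e^{σΔ}θ‖ ≤ K σ^{-1/2}`, `σ ≥ 1`; e.g. a difference of translates, or a derivative, of a test
field). Then for every `ε > 0` there is a smooth compactly supported `W` with
`∫ ‖ΔW + θ‖ ≤ ε`. Construction: `W = η_R 𝒰₁[χ(t/T)θ](0)` with the caloric potential
`V = 𝒰₁[χ(t/T)θ](0) = ∫₀^{2T} χ(σ/T) e^{σΔ}θ dσ`, which solves `ΔV = -θ - r` with
`‖r‖_{L¹} ≤ BKT^{-1/2}` (`integral_norm_heatDuhamelBack_timeDeriv_le`), and the spatial cut-off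
`η_R`, whose gradient and Laplacian are `O(R⁻¹)`, `O(R⁻²)` while `V, DV ∈ L¹`. [folklore] -/
theorem exists_test_integral_norm_laplacian_add_le {θ : E → E}
    (hθ : FunctionSpaces.IsTestFunctionOn (⊤ : Opens E) θ)
    (hdecay : ∃ K : ℝ, ∀ σ : ℝ, 1 ≤ σ →
      ∫ x, ‖UnboundedOperators.heatExtension θ σ x‖ ≤ K * σ ^ (-(1 / 2 : ℝ)))
    {ε : ℝ} (hε : 0 < ε) :
    ∃ W : E → E, FunctionSpaces.IsTestFunctionOn (⊤ : Opens E) W ∧ ∫ x, ‖Δ W x + θ x‖ ≤ ε := by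
  obtain ⟨K, hK⟩ := hdecay
  set χ : ℝ → ℝ := ⇑(FunctionSpaces.dyadicCutoff ℝ) with hχ_def
  have hχs : ContDiff ℝ (⊤ : ℕ∞) χ := (FunctionSpaces.dyadicCutoff ℝ).contDiff
  obtain ⟨B, hB⟩ : ∃ B : ℝ, ∀ t, |deriv χ t| ≤ B := by
    obtain ⟨B, hB⟩ := (hχs.continuous_deriv (by simp)).bounded_above_of_compact_support
      ((FunctionSpaces.dyadicCutoff ℝ).hasCompactSupport.deriv)
    exact ⟨B, fun t => by simpa [Real.norm_eq_abs] using hB t⟩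
  have hK0 : 0 ≤ K := by
    have h := hK 1 le_rfl
    rw [Real.one_rpow, mul_one] at h
    exact (integral_nonneg fun _ => norm_nonneg _).trans h
  have hB0 : 0 ≤ B := (abs_nonneg _).trans (hB 0)
  -- choose `T ≥ 1` with `B K T^{-1/2} ≤ ε / 2`
  obtain ⟨T, hT1, hTε⟩ : ∃ T : ℝ, 1 ≤ T ∧ B * K * T ^ (-(1 / 2 : ℝ)) ≤ ε / 2 := by
    have ht : Tendsto (fun T : ℝ => B * K * T ^ (-(1 / 2 : ℝ))) atTop (𝓝 0) := by
      have h := (tendsto_rpow_neg_atTop (y := (1 / 2 : ℝ)) (by norm_num)).const_mul (B * K)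
      rwa [mul_zero] at h
    have hev := (ht.eventually_le_const (half_pos hε)).and (eventually_ge_atTop (1 : ℝ))
    obtain ⟨T, hT⟩ := hev.exists
    exact ⟨T, hT.2, hT.1⟩
  have hT0 : 0 < T := one_pos.trans_le hT1
  -- the potential `V` and the remainder `r`
  obtain ⟨hζs, hζc, hζ0⟩ := dyadic_timeProfile hT0
  set Θ : ℝ → E → E := fun t x => χ (t / T) • θ x with hΘ_def
  have hΘ : IsSpaceTimeTestOn (⊤ : Opens (ℝ × E)) Θ := isSpaceTimeTestOn_time_smul hζs hζc hθ
  have hΘ' : IsSpaceTimeTestOn (⊤ : Opens (ℝ × E)) (timeDeriv Θ) := hΘ.timeDeriv_top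
  have hΘD : IsSpaceTimeTestOn (⊤ : Opens (ℝ × E)) (fun t y => fderiv ℝ (Θ t) y) := hΘ.fderiv_top
  set V : E → E := heatDuhamelBack 1 Θ 0 with hV_def
  set r : E → E := heatDuhamelBack 1 (timeDeriv Θ) 0 with hr_def
  have hVs : ContDiff ℝ (⊤ : ℕ∞) V := hΘ.contDiff_heatDuhamelBack one_pos 0
  have hV2 : ContDiff ℝ 2 V := contDiff_infty.1 hVs 2
  have hVi : Integrable V volume := hΘ.integrable_heatDuhamelBack one_pos 0
  have hDV : (fun x => fderiv ℝ V x) = heatDuhamelBack 1 (fun t y => fderiv ℝ (Θ t) y) 0 :=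
    hΘ.fderiv_heatDuhamelBack one_pos 0
  have hDVi : Integrable (fun x => fderiv ℝ V x) volume := by
    rw [hDV]
    exact hΘD.integrable_heatDuhamelBack one_pos 0
  have hri : Integrable r volume := hΘ'.integrable_heatDuhamelBack one_pos 0
  have hPoisson : ∀ x, Δ V x = -θ x - r x := fun x => by
    have h := hΘ.smul_laplacian_heatDuhamelBack one_pos 0 x
    rw [one_smul] at h
    have hΘ0 : Θ 0 x = θ x := by
      show χ (0 / T) • θ x = θ x
      rw [show χ (0 / T) = 1 from hζ0, one_smul]
    rw [hΘ0] at h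
    exact h
  have hr : ∫ x, ‖r x‖ ≤ ε / 2 :=
    (integral_norm_heatDuhamelBack_timeDeriv_le hθ hK hB hT1).trans hTε
  -- cut-off constants and the support radius of `θ`
  obtain ⟨C₁, hC₁0, hC₁⟩ := exists_norm_fderiv_cutoff_le (E := E)
  obtain ⟨C₂, hC₂0, hC₂⟩ := exists_abs_laplacian_cutoff_le (E := E)
  obtain ⟨R₀, hR₀⟩ := hθ.hasCompactSupport.isCompact.isBounded.subset_closedBall (0 : E)
  set I₀ : ℝ := ∫ x, ‖V x‖ with hI₀
  set I₁ : ℝ := ∫ x, ‖fderiv ℝ V x‖ with hI₁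
  set n : ℝ := (Module.finrank ℝ E : ℝ) with hn
  set c : ℝ := 2 * n * C₁ * I₁ + C₂ * I₀ with hc_def
  have hI₀0 : 0 ≤ I₀ := integral_nonneg fun _ => norm_nonneg _
  have hI₁0 : 0 ≤ I₁ := integral_nonneg fun _ => norm_nonneg _
  have hc0 : 0 ≤ c := by positivity
  -- choose `R ≥ max R₀ 1` with `c / R ≤ ε / 2`
  obtain ⟨R, hR1, hRR₀, hRε⟩ : ∃ R : ℝ, 1 ≤ R ∧ R₀ ≤ R ∧ c / R ≤ ε / 2 := by
    have ht : Tendsto (fun R : ℝ => c / R) atTop (𝓝 0) := by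
      have h := (tendsto_inv_atTop_zero (𝕜 := ℝ)).const_mul c
      rw [mul_zero] at h
      simpa only [div_eq_mul_inv] using h
    have hev := ((ht.eventually_le_const (half_pos hε)).and (eventually_ge_atTop (1 : ℝ))).and
      (eventually_ge_atTop R₀)
    obtain ⟨R, ⟨hR, hR1⟩, hR0⟩ := hev.exists
    exact ⟨R, hR1, hR0, hR⟩
  have hR0 : 0 < R := one_pos.trans_le hR1
  -- the truncated potential
  set η : E → ℝ := cutoff R with hη_def
  have hηs : ContDiff ℝ (⊤ : ℕ∞) η := contDiff_cutoff R
  have hη2 : ContDiff ℝ 2 η := contDiff_cutoff R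
  set W : E → E := fun x => η x • V x with hW_def
  have hW : FunctionSpaces.IsTestFunctionOn (⊤ : Opens E) W :=
    ⟨hηs.smul hVs, (hasCompactSupport_cutoff hR0).smul_right, by simp⟩
  refine ⟨W, hW, ?_⟩
  -- pointwise bound for `ΔW + θ`
  have hpt : ∀ x, ‖Δ W x + θ x‖ ≤
      ‖r x‖ + 2 * n * (C₁ / R) * ‖fderiv ℝ V x‖ + C₂ / R ^ 2 * ‖V x‖ := by
    intro x
    have hL := laplacian_smul_apply hη2 hV2 x
    have hkill : η x • (-θ x - r x) + θ x = -(η x • r x) := by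
      by_cases hx : ‖x‖ ≤ R
      · rw [hη_def, cutoff_eq_one hR0 hx, one_smul, one_smul]
        abel
      · have hθx : θ x = 0 := by
          refine image_eq_zero_of_notMem_tsupport fun h => hx ?_
          have h' := hR₀ h
          rw [mem_closedBall_zero_iff] at h'
          exact h'.trans hRR₀
        rw [hθx]
        simp
    have heq : Δ W x + θ x = -(η x • r x) +
        ((2 : ℝ) • ∑ i, (fderiv ℝ η x (stdOrthonormalBasis ℝ E i)) •
          fderiv ℝ V x (stdOrthonormalBasis ℝ E i)) + (Δ η x) • V x := by
      rw [show Δ W x = Δ (fun y => η y • V y) x from rfl, hL, hPoisson x, ← hkill]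
      abel
    rw [heq]
    refine (norm_add₃_le).trans ?_
    refine add_le_add (add_le_add ?_ ?_) ?_
    · rw [norm_neg, norm_smul, Real.norm_eq_abs]
      calc |η x| * ‖r x‖ ≤ 1 * ‖r x‖ :=
            mul_le_mul_of_nonneg_right (abs_cutoff_le_one R x) (norm_nonneg _)
        _ = ‖r x‖ := one_mul _
    · refine (norm_two_smul_sum_fderiv_smul_fderiv_le x).trans ?_
      have h1 : ‖fderiv ℝ η x‖ ≤ C₁ / R := hC₁ R hR0 x
      calc 2 * (Module.finrank ℝ E : ℝ) * (‖fderiv ℝ η x‖ * ‖fderiv ℝ V x‖)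
          ≤ 2 * n * (C₁ / R * ‖fderiv ℝ V x‖) := by
            rw [← hn]
            refine mul_le_mul_of_nonneg_left
              (mul_le_mul_of_nonneg_right h1 (norm_nonneg _)) (by positivity)
        _ = 2 * n * (C₁ / R) * ‖fderiv ℝ V x‖ := by ring
    · rw [norm_smul, Real.norm_eq_abs]
      exact mul_le_mul_of_nonneg_right (hC₂ R hR0 x) (norm_nonneg _)
  -- integrate
  have hWl := hW.laplacian_top
  have hint : Integrable (fun x => ‖Δ W x + θ x‖) volume :=
    ((hWl.contDiff.continuous.add hθ.contDiff.continuous).integrable_of_hasCompactSupport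
      (hWl.hasCompactSupport.add hθ.hasCompactSupport)).norm
  have hmaj : Integrable (fun x => ‖r x‖ + 2 * n * (C₁ / R) * ‖fderiv ℝ V x‖ + C₂ / R ^ 2 * ‖V x‖)
      volume := (hri.norm.add (hDVi.norm.const_mul _)).add (hVi.norm.const_mul _)
  calc ∫ x, ‖Δ W x + θ x‖
      ≤ ∫ x, (‖r x‖ + 2 * n * (C₁ / R) * ‖fderiv ℝ V x‖ + C₂ / R ^ 2 * ‖V x‖) :=
        integral_mono hint hmaj hpt
    _ = (∫ x, ‖r x‖) + 2 * n * (C₁ / R) * I₁ + C₂ / R ^ 2 * I₀ := by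
        have i1 : Integrable (fun x => ‖r x‖) volume := hri.norm
        have i2 : Integrable (fun x => 2 * n * (C₁ / R) * ‖fderiv ℝ V x‖) volume :=
          hDVi.norm.const_mul _
        have i3 : Integrable (fun x => C₂ / R ^ 2 * ‖V x‖) volume := hVi.norm.const_mul _
        have i12 : Integrable (fun x => ‖r x‖ + 2 * n * (C₁ / R) * ‖fderiv ℝ V x‖) volume :=
          i1.add i2
        rw [integral_add i12 i3, integral_add i1 i2, integral_const_mul, integral_const_mul]
    _ ≤ ε / 2 + c / R := by
        have h2 : C₂ / R ^ 2 * I₀ ≤ C₂ / R * I₀ := by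
          refine mul_le_mul_of_nonneg_right ?_ hI₀0
          refine div_le_div_of_nonneg_left hC₂0 hR0 ?_
          nlinarith
        have h3 : 2 * n * (C₁ / R) * I₁ + C₂ / R * I₀ = c / R := by
          rw [hc_def]
          field_simp
        linarith [hr, h2, h3]
    _ ≤ ε := by linarith [hRε]

end Potential

/-! ### Differences of translates: `θ - θ(· - b) = ∂_b Ξ` and their caloric decay -/

section Translate

omit [MeasurableSpace E] [BorelSpace E] in
/-- **The averaged translate** `Ξ(x) = ∫₀¹ θ(x - s b) ds` of a test field is a test field with
`DΞ(x) b = θ(x) - θ(x - b)` (smoothness of parametric integrals; the fundamental theorem of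
calculus along `s ↦ x - s b`). [folklore] -/
theorem exists_test_fderiv_apply_eq_sub_translate {θ : E → E}
    (hθ : FunctionSpaces.IsTestFunctionOn (⊤ : Opens E) θ) (b : E) :
    ∃ Ξ : E → E, FunctionSpaces.IsTestFunctionOn (⊤ : Opens E) Ξ ∧
      ∀ x, fderiv ℝ Ξ x b = θ x - θ (x - b) := by
  set f : E → ℝ → E := fun x s => θ (x - s • b) with hf_def
  have hA : ∀ p : E × ℝ, HasFDerivAt (fun q : E × ℝ => q.1 - q.2 • b)
      (ContinuousLinearMap.fst ℝ E ℝ - (ContinuousLinearMap.snd ℝ E ℝ).smulRight b) p := fun p =>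
    hasFDerivAt_fst.sub (hasFDerivAt_snd.smul_const b)
  have hf : ContDiff ℝ (⊤ : ℕ∞) (uncurry f) :=
    hθ.contDiff.comp (contDiff_fst.sub (contDiff_snd.smul contDiff_const))
  have hf1 : ContDiff ℝ 1 (uncurry f) := contDiff_infty.1 hf 1
  have hθd : Differentiable ℝ θ := hθ.contDiff.differentiable (by simp)
  -- the derivative of `uncurry f` at `(x, s)` applied to `(b, 0)`
  have hDf : ∀ x (s : ℝ), fderiv ℝ (uncurry f) (x, s) (b, 0) = fderiv ℝ θ (x - s • b) b := by
    intro x s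
    have h : HasFDerivAt (uncurry f) ((fderiv ℝ θ (x - s • b)).comp
        (ContinuousLinearMap.fst ℝ E ℝ - (ContinuousLinearMap.snd ℝ E ℝ).smulRight b)) (x, s) :=
      (hθd (x - s • b)).hasFDerivAt.comp (x, s) (hA (x, s))
    rw [h.fderiv]
    simp
  obtain ⟨R₀, hR₀⟩ := hθ.hasCompactSupport.isCompact.isBounded.subset_closedBall (0 : E)
  refine ⟨fun x => ∫ s in (0 : ℝ)..1, f x s, ⟨contDiff_intervalIntegral_of_contDiff hf 0 1, ?_, by simp⟩,
    fun x => ?_⟩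
  · -- support in the closed ball of radius `R₀ + ‖b‖`
    refine HasCompactSupport.intro (isCompact_closedBall (0 : E) (max R₀ 0 + ‖b‖)) fun x hx => ?_
    rw [mem_closedBall_zero_iff, not_le] at hx
    have hzero : EqOn (fun s => f x s) (fun _ => 0) (uIcc 0 1) := fun s hs => by
      rw [uIcc_of_le zero_le_one] at hs
      show θ (x - s • b) = 0
      refine image_eq_zero_of_notMem_tsupport (f := θ) fun h => ?_
      have h' := mem_closedBall_zero_iff.1 (hR₀ h)
      have hsb : ‖s • b‖ ≤ ‖b‖ := by
        rw [norm_smul, Real.norm_of_nonneg hs.1]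
        exact mul_le_of_le_one_left (norm_nonneg _) hs.2
      have := norm_sub_norm_le x (s • b)
      linarith [le_max_left R₀ 0]
    show (∫ s in (0 : ℝ)..1, f x s) = 0
    rw [intervalIntegral.integral_congr hzero, intervalIntegral.integral_const, smul_zero]
  · have hD := hasFDerivAt_intervalIntegral_of_contDiff hf1 0 1 x
    rw [hD.fderiv]
    have hii : IntervalIntegrable (fun s => (fderiv ℝ (uncurry f) (x, s)).comp
        (ContinuousLinearMap.inl ℝ E ℝ)) volume 0 1 :=
      (((hf1.continuous_fderiv one_ne_zero).comp (Continuous.prodMk_right x)).clm_comp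
        continuous_const).intervalIntegrable _ _
    rw [ContinuousLinearMap.intervalIntegral_apply hii]
    simp only [ContinuousLinearMap.coe_comp, Function.comp_apply, ContinuousLinearMap.inl_apply]
    simp_rw [hDf]
    -- fundamental theorem of calculus along `s ↦ x - s • b`
    have hg : ∀ s : ℝ, HasDerivAt (fun s : ℝ => θ (x - s • b)) (-(fderiv ℝ θ (x - s • b) b)) s := by
      intro s
      have hpath : HasDerivAt (fun s : ℝ => x - s • b) (-b) s := by
        simpa using ((hasDerivAt_id s).smul_const b).const_sub x
      have h := (hθd (x - s • b)).hasFDerivAt.comp_hasDerivAt s hpath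
      simpa [Function.comp_def] using h
    have hint : IntervalIntegrable (fun s => -(fderiv ℝ θ (x - s • b) b)) volume 0 1 := by
      refine (Continuous.neg ?_).intervalIntegrable _ _
      exact ((hθ.contDiff.continuous_fderiv (by simp)).comp
        (continuous_const.sub (continuous_id.smul continuous_const))).clm_apply continuous_const
    have key := intervalIntegral.integral_eq_sub_of_hasDerivAt (fun s _ => hg s) hint
    rw [intervalIntegral.integral_neg, one_smul, zero_smul, sub_zero] at key
    have key' : ∫ s in (0 : ℝ)..1, fderiv ℝ θ (x - s • b) b = -(θ (x - b) - θ x) := by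
      rw [← key, neg_neg]
    rw [key']
    abel

/-- **Caloric decay of a directional derivative of a test field in `L¹`**:
`∫ ‖e^{σΔ}(∂_b Ξ)‖ ≤ K σ^{-1/2}` for `σ > 0` (the derivative falls on the caloric extension,
`e^{σΔ}∂_bΞ = ∂_b e^{σΔ}Ξ`, and `‖∇e^{σΔ}Ξ‖_{L¹} ≤ C σ^{-1/2} ‖Ξ‖_{L¹}`,
`Literature.Analysis.UnboundedOperators.eLpNorm_fderiv_heatExtension_le`). [folklore] -/
theorem exists_integral_norm_heatExtension_fderiv_apply_le {Ξ : E → E}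
    (hΞ : FunctionSpaces.IsTestFunctionOn (⊤ : Opens E) Ξ) (b : E) :
    ∃ K : ℝ, ∀ σ : ℝ, 0 < σ →
      ∫ x, ‖UnboundedOperators.heatExtension (fun z => fderiv ℝ Ξ z b) σ x‖ ≤ K * σ ^ (-(1 / 2 : ℝ)) := by
  obtain ⟨C, hC⟩ := UnboundedOperators.eLpNorm_fderiv_heatExtension_le_holds (E := E) (F := E)
    (p := 1) le_rfl
  have hΞ1 : ContDiff ℝ 1 Ξ := contDiff_infty.1 hΞ.contDiff 1
  have hΞp : MemLp Ξ 1 (volume : Measure E) :=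
    hΞ.contDiff.continuous.memLp_of_hasCompactSupport hΞ.hasCompactSupport
  have hfin : eLpNorm Ξ 1 (volume : Measure E) < ⊤ := hΞp.eLpNorm_lt_top
  refine ⟨‖b‖ * (C * (eLpNorm Ξ 1 (volume : Measure E)).toReal), fun σ hσ => ?_⟩
  -- `e^{σΔ}(∂_b Ξ) = ∂_b e^{σΔ} Ξ`
  have hswap : ∀ x, UnboundedOperators.heatExtension (fun z => fderiv ℝ Ξ z b) σ x =
      fderiv ℝ (UnboundedOperators.heatExtension Ξ σ) x b := fun x =>
    (UnboundedOperators.fderiv_heatExtension_apply_of_hasCompactSupport hΞ1 hΞ.hasCompactSupport σ x b).symm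
  -- the gradient of the caloric extension is integrable, with the `L¹` smoothing bound
  have hDc : Continuous (fderiv ℝ Ξ) := hΞ1.continuous_fderiv one_ne_zero
  obtain ⟨hDi, -⟩ := integral_norm_heatExtension_le hDc (hΞ.hasCompactSupport.fderiv ℝ) hσ
  have hDeq : fderiv ℝ (UnboundedOperators.heatExtension Ξ σ) =
      UnboundedOperators.heatExtension (fderiv ℝ Ξ) σ :=
    funext fun x => UnboundedOperators.fderiv_heatExtension_of_hasCompactSupport hΞ1 hΞ.hasCompactSupport σ x
  have hDi' : Integrable (fderiv ℝ (UnboundedOperators.heatExtension Ξ σ)) volume := by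
    rw [hDeq]; exact hDi
  have hbound : ∫ x, ‖fderiv ℝ (UnboundedOperators.heatExtension Ξ σ) x‖ ≤
      C * (eLpNorm Ξ 1 (volume : Measure E)).toReal * σ ^ (-(1 / 2 : ℝ)) := by
    rw [integral_norm_eq_lintegral_enorm hDi'.aestronglyMeasurable, ← eLpNorm_one_eq_lintegral_enorm]
    have h := hC Ξ hΞp σ hσ
    have hfin' : (C : ℝ≥0∞) * ENNReal.ofReal (σ ^ (-(1 / 2 : ℝ))) * eLpNorm Ξ 1 volume ≠ ⊤ :=
      ENNReal.mul_ne_top (ENNReal.mul_ne_top ENNReal.coe_ne_top ENNReal.ofReal_ne_top) hfin.ne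
    refine (ENNReal.toReal_mono hfin' h).trans_eq ?_
    rw [ENNReal.toReal_mul, ENNReal.toReal_mul, ENNReal.coe_toReal,
      ENNReal.toReal_ofReal (Real.rpow_nonneg hσ.le _)]
    ring
  calc ∫ x, ‖UnboundedOperators.heatExtension (fun z => fderiv ℝ Ξ z b) σ x‖
      = ∫ x, ‖fderiv ℝ (UnboundedOperators.heatExtension Ξ σ) x b‖ := by simp_rw [hswap]
    _ ≤ ∫ x, ‖b‖ * ‖fderiv ℝ (UnboundedOperators.heatExtension Ξ σ) x‖ := by
        refine integral_mono_of_nonneg (Eventually.of_forall fun _ => norm_nonneg _)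
          (hDi'.norm.const_mul _) (Eventually.of_forall fun x => ?_)
        show ‖fderiv ℝ (UnboundedOperators.heatExtension Ξ σ) x b‖ ≤
          ‖b‖ * ‖fderiv ℝ (UnboundedOperators.heatExtension Ξ σ) x‖
        rw [mul_comm]
        exact (fderiv ℝ (UnboundedOperators.heatExtension Ξ σ) x).le_opNorm b
    _ = ‖b‖ * ∫ x, ‖fderiv ℝ (UnboundedOperators.heatExtension Ξ σ) x‖ := integral_const_mul _ _
    _ ≤ ‖b‖ * (C * (eLpNorm Ξ 1 (volume : Measure E)).toReal * σ ^ (-(1 / 2 : ℝ))) :=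
        mul_le_mul_of_nonneg_left hbound (norm_nonneg _)
    _ = ‖b‖ * (C * (eLpNorm Ξ 1 (volume : Measure E)).toReal) * σ ^ (-(1 / 2 : ℝ)) := by ring

end Translate

/-! ### Weak-* continuity in time -/

section WeakStar

variable {u : ℝ → E → E} {M : ℝ}

/-- **Pairings with Laplacians of test fields are continuous in time** whenever the pairings
with divergence-free test fields are, for a family of bounded, measurable, weakly
divergence-free slices (`∫⟪u(t), ΔW⟫ = ∫⟪u(t), ΔW - ∇div W⟫`, a divergence-free test). [folklore] -/
theorem continuousOn_integral_inner_laplacian_of_divFree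
    (hM : ∀ t < 0, ∀ x, ‖u t x‖ ≤ M) (hmeas : ∀ t < 0, AEStronglyMeasurable (u t) volume)
    (hdiv : ∀ t < 0, IsWeaklyDivFree (u t))
    (hcont : ∀ φ : E → E, FunctionSpaces.IsTestFunctionOn (⊤ : Opens E) φ → VectorCalculus.IsDivFree φ →
      ContinuousOn (fun t => ∫ x, ⟪u t x, φ x⟫) (Iio 0))
    {W : E → E} (hW : FunctionSpaces.IsTestFunctionOn (⊤ : Opens E) W) :
    ContinuousOn (fun t => ∫ x, ⟪u t x, Δ W x⟫) (Iio 0) := by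
  obtain ⟨hξ, hξd⟩ := hW.laplacian_sub_gradient_divergence
  refine (hcont _ hξ hξd).congr fun t ht => ?_
  have hloc : LocallyIntegrable (u t) volume :=
    (memLp_top_of_bound (hmeas t ht) M (Eventually.of_forall (hM t ht))).locallyIntegrable le_top
  exact (hdiv t ht).integral_inner_laplacian_eq hloc hW

/-- **Weak-* continuity in time against differences of translates.** Let `u(t)`, `t < 0`, be
bounded by `M`, measurable and weakly divergence free, with `t ↦ ∫⟪u(t), φ⟫` continuous on
`(-∞, 0)` for every divergence-free test field `φ` (as for bounded ancient mild solutions,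
`IsBoundedAncientMildSolution.continuousOn_integral_inner`). Then `t ↦ ∫⟪u(t), θ - θ(· - b)⟫` is
continuous on `(-∞, 0)` for *every* test field `θ` and every `b`: `θ - θ(· - b) = ∂_bΞ` has
caloric decay, hence is `-ΔW` up to an `L¹`-small error for a test field `W`
(`exists_test_integral_norm_laplacian_add_le`), and `∫⟪u(t), ΔW⟫` is continuous in `t`; a
uniform limit of continuous functions is continuous. The translate is what a spatial constant
cannot see: `θ` and `θ(· - b)` have the same mean. [folklore] -/
theorem continuousOn_integral_inner_sub_translate
    (hM : ∀ t < 0, ∀ x, ‖u t x‖ ≤ M) (hmeas : ∀ t < 0, AEStronglyMeasurable (u t) volume)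
    (hdiv : ∀ t < 0, IsWeaklyDivFree (u t))
    (hcont : ∀ φ : E → E, FunctionSpaces.IsTestFunctionOn (⊤ : Opens E) φ → VectorCalculus.IsDivFree φ →
      ContinuousOn (fun t => ∫ x, ⟪u t x, φ x⟫) (Iio 0))
    {θ : E → E} (hθ : FunctionSpaces.IsTestFunctionOn (⊤ : Opens E) θ) (b : E) :
    ContinuousOn (fun t => ∫ x, ⟪u t x, θ x - θ (x - b)⟫) (Iio 0) := by
  obtain ⟨Ξ, hΞ, hΞb⟩ := exists_test_fderiv_apply_eq_sub_translate hθ b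
  have hθ' : FunctionSpaces.IsTestFunctionOn (⊤ : Opens E) (fun x => fderiv ℝ Ξ x b) :=
    hΞ.fderiv_apply_const b
  have hdecay : ∃ K : ℝ, ∀ σ : ℝ, 1 ≤ σ →
      ∫ x, ‖UnboundedOperators.heatExtension (fun z => fderiv ℝ Ξ z b) σ x‖ ≤ K * σ ^ (-(1 / 2 : ℝ)) := by
    obtain ⟨K, hK⟩ := exists_integral_norm_heatExtension_fderiv_apply_le hΞ b
    exact ⟨K, fun σ hσ => hK σ (one_pos.trans_le hσ)⟩
  have hM0 : 0 ≤ M := (norm_nonneg _).trans (hM (-1) (by norm_num) 0)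
  refine continuousOn_of_uniform_approx_of_continuousOn fun U hU => ?_
  obtain ⟨ε, hε, hεU⟩ := Metric.mem_uniformity_dist.1 hU
  have hε' : 0 < ε / (M + 1) := by positivity
  obtain ⟨W, hW, hWε⟩ := exists_test_integral_norm_laplacian_add_le hθ' hdecay hε'
  refine ⟨fun t => -∫ x, ⟪u t x, Δ W x⟫,
    (continuousOn_integral_inner_laplacian_of_divFree hM hmeas hdiv hcont hW).neg, fun t ht => hεU ?_⟩
  have hWl := hW.laplacian_top
  have i1 : Integrable (fun x => ⟪u t x, θ x - θ (x - b)⟫) volume := by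
    have h : Integrable (fun x => fderiv ℝ Ξ x b) volume :=
      hθ'.contDiff.continuous.integrable_of_hasCompactSupport hθ'.hasCompactSupport
    refine (integrable_inner_of_aestronglyMeasurable_of_norm_le (hmeas t ht) (hM t ht) h).congr ?_
    exact Eventually.of_forall fun x => by simp only [hΞb]
  have i2 : Integrable (fun x => ⟪u t x, Δ W x⟫) volume :=
    integrable_inner_of_aestronglyMeasurable_of_norm_le (hmeas t ht) (hM t ht)
      (hWl.contDiff.continuous.integrable_of_hasCompactSupport hWl.hasCompactSupport)
  have i3 : Integrable (fun x => ‖Δ W x + fderiv ℝ Ξ x b‖) volume :=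
    ((hWl.contDiff.continuous.add hθ'.contDiff.continuous).integrable_of_hasCompactSupport
      (hWl.hasCompactSupport.add hθ'.hasCompactSupport)).norm
  rw [Real.dist_eq, sub_neg_eq_add, ← integral_add i1 i2]
  have heq : (fun x => ⟪u t x, θ x - θ (x - b)⟫ + ⟪u t x, Δ W x⟫) =
      fun x => ⟪u t x, Δ W x + fderiv ℝ Ξ x b⟫ := by
    funext x
    rw [← inner_add_right, hΞb, add_comm]
  rw [heq]
  calc |∫ x, ⟪u t x, Δ W x + fderiv ℝ Ξ x b⟫|
      ≤ ∫ x, ‖⟪u t x, Δ W x + fderiv ℝ Ξ x b⟫‖ := by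
        rw [← Real.norm_eq_abs]
        exact norm_integral_le_integral_norm _
    _ ≤ ∫ x, M * ‖Δ W x + fderiv ℝ Ξ x b‖ := by
        refine integral_mono_of_nonneg (Eventually.of_forall fun _ => norm_nonneg _)
          (i3.const_mul M) (Eventually.of_forall fun x => ?_)
        exact (norm_inner_le_norm _ _).trans (mul_le_mul_of_nonneg_right (hM t ht x) (norm_nonneg _))
    _ = M * ∫ x, ‖Δ W x + fderiv ℝ Ξ x b‖ := integral_const_mul _ _
    _ ≤ M * (ε / (M + 1)) := mul_le_mul_of_nonneg_left hWε hM0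
    _ < ε := by
        rw [mul_div_assoc']
        rw [div_lt_iff₀ (by positivity)]
        nlinarith

end WeakStar

section WeakStarR3

open WithLp

/-- The cylindrical radius is `1`-Lipschitz: `r(y) ≤ r(x) + ‖y - x‖` (it is the norm of the
projection to the horizontal plane). [folklore] -/
theorem cylRadius_le_cylRadius_add_norm_sub (x y : EuclideanSpace ℝ (Fin 3)) : cylRadius y ≤ cylRadius x + ‖y - x‖ := by
  have key : ∀ v : EuclideanSpace ℝ (Fin 3), cylRadius v = ‖(toLp 2 ![v 0, v 1] : EuclideanSpace ℝ (Fin 2))‖ := by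
    intro v
    rw [cylRadius, EuclideanSpace.norm_eq]
    congr 1
    simp [Fin.sum_univ_two, sq_abs]
  have hD : ‖(toLp 2 ![(y - x) 0, (y - x) 1] : EuclideanSpace ℝ (Fin 2))‖ ≤ ‖y - x‖ := by
    rw [EuclideanSpace.norm_eq, EuclideanSpace.norm_eq (y - x)]
    refine Real.sqrt_le_sqrt ?_
    simp only [Fin.sum_univ_two, Fin.sum_univ_three, Real.norm_eq_abs, sq_abs,
      Matrix.cons_val_zero, Matrix.cons_val_one]
    nlinarith [sq_nonneg ((y - x) 2)]
  have hsum : (toLp 2 ![y 0, y 1] : EuclideanSpace ℝ (Fin 2)) =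
      toLp 2 ![x 0, x 1] + toLp 2 ![(y - x) 0, (y - x) 1] := by
    ext i
    fin_cases i <;> simp
  rw [key y, key x, hsum]
  exact (norm_add_le _ _).trans (add_le_add_right hD _)

/-- **Weak-* continuity in time of decaying bounded ancient families on `EuclideanSpace ℝ (Fin 3)`.** Let
`u(t) : EuclideanSpace ℝ (Fin 3) → EuclideanSpace ℝ (Fin 3)`, `t < 0`, be bounded, measurable and weakly divergence free, with continuous
pairings `t ↦ ∫⟪u(t), φ⟫` for all divergence-free test fields `φ`, and obeying the decay
`r ‖u(t, x)‖ ≤ C` (`r` the cylindrical radius). Then `t ↦ ∫⟪u(t), θ⟫` is continuous on `(-∞, 0)`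
for *every* test field `θ`: write `θ = (θ - θ(· - b)) + θ(· - b)` with `b = L e₀` far from the
axis; the first pairing is continuous (`continuousOn_integral_inner_sub_translate`) and the
second is uniformly small, `|∫⟪u(t), θ(· - b)⟫| ≤ C‖θ‖_{L¹}/(L - R₀)`, by the decay — which is
how the decay bound pins the spatially constant ambiguity `b(t)` of KNSS 2009, §1. [folklore] -/
theorem continuousOn_integral_inner_of_cylRadius_decay {u : ℝ → EuclideanSpace ℝ (Fin 3) → EuclideanSpace ℝ (Fin 3)} {M : ℝ}
    (hM : ∀ t < 0, ∀ x, ‖u t x‖ ≤ M) (hmeas : ∀ t < 0, AEStronglyMeasurable (u t) volume)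
    (hdiv : ∀ t < 0, IsWeaklyDivFree (u t))
    (hcont : ∀ φ : EuclideanSpace ℝ (Fin 3) → EuclideanSpace ℝ (Fin 3), FunctionSpaces.IsTestFunctionOn (⊤ : Opens (EuclideanSpace ℝ (Fin 3))) φ → VectorCalculus.IsDivFree φ →
      ContinuousOn (fun t => ∫ x, ⟪u t x, φ x⟫) (Iio 0))
    {C : ℝ} (hC : ∀ t < 0, ∀ x, cylRadius x * ‖u t x‖ ≤ C)
    {θ : EuclideanSpace ℝ (Fin 3) → EuclideanSpace ℝ (Fin 3)} (hθ : FunctionSpaces.IsTestFunctionOn (⊤ : Opens (EuclideanSpace ℝ (Fin 3))) θ) :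
    ContinuousOn (fun t => ∫ x, ⟪u t x, θ x⟫) (Iio 0) := by
  have hC0 : 0 ≤ C := by
    have h := hC (-1) (by norm_num) 0
    have h0 : cylRadius (0 : EuclideanSpace ℝ (Fin 3)) = 0 := (cylRadius_eq_zero_iff 0).2 ⟨rfl, rfl⟩
    rw [h0, zero_mul] at h
    exact h
  obtain ⟨R₀', hR₀'⟩ := hθ.hasCompactSupport.isCompact.isBounded.subset_closedBall (0 : EuclideanSpace ℝ (Fin 3))
  set R₀ : ℝ := max R₀' 0 with hR₀_def
  have hR₀ : tsupport θ ⊆ Metric.closedBall (0 : EuclideanSpace ℝ (Fin 3)) R₀ :=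
    hR₀'.trans (Metric.closedBall_subset_closedBall (le_max_left _ _))
  set N : ℝ := ∫ x, ‖θ x‖ with hN_def
  have hN0 : 0 ≤ N := integral_nonneg fun _ => norm_nonneg _
  have hθi : Integrable θ volume :=
    hθ.contDiff.continuous.integrable_of_hasCompactSupport hθ.hasCompactSupport
  refine continuousOn_of_uniform_approx_of_continuousOn fun U hU => ?_
  obtain ⟨ε, hε, hεU⟩ := Metric.mem_uniformity_dist.1 hU
  -- the far translate `b = L e₀`
  set L : ℝ := R₀ + 1 + C * N / ε with hL_def
  have hLR : 0 < L - R₀ := by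
    have : 0 ≤ C * N / ε := by positivity
    rw [hL_def]; linarith
  have hsmall : C * N / (L - R₀) < ε := by
    rw [div_lt_iff₀ hLR, hL_def]
    have h1 : C * N = C * N / ε * ε := by field_simp
    nlinarith [mul_pos hε hε, hε]
  set b : EuclideanSpace ℝ (Fin 3) := EuclideanSpace.single 0 L with hb_def
  have hL0 : 0 ≤ L := by linarith [le_max_right R₀' 0]
  have hcb : cylRadius b = L := by
    rw [hb_def, cylRadius]
    simp [hL0]
  refine ⟨fun t => ∫ x, ⟪u t x, θ x - θ (x - b)⟫,
    continuousOn_integral_inner_sub_translate hM hmeas hdiv hcont hθ b, fun t ht => hεU ?_⟩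
  -- the pairing with the far translate is uniformly small
  have hθbi : Integrable (fun x => θ (x - b)) volume := hθi.comp_sub_right b
  have i1 : Integrable (fun x => ⟪u t x, θ x⟫) volume :=
    integrable_inner_of_aestronglyMeasurable_of_norm_le (hmeas t ht) (hM t ht) hθi
  have i2 : Integrable (fun x => ⟪u t x, θ (x - b)⟫) volume :=
    integrable_inner_of_aestronglyMeasurable_of_norm_le (hmeas t ht) (hM t ht) hθbi
  have hsplit : (∫ x, ⟪u t x, θ x⟫) - ∫ x, ⟪u t x, θ x - θ (x - b)⟫ = ∫ x, ⟪u t x, θ (x - b)⟫ := by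
    rw [sub_eq_iff_eq_add, ← integral_add i2 (i1.sub i2 |>.congr (Eventually.of_forall fun x => by
      simp only [Pi.sub_apply, inner_sub_right]))]
    refine integral_congr_ae (Eventually.of_forall fun x => ?_)
    simp only [inner_sub_right]
    ring
  have hpt : ∀ x, ‖⟪u t x, θ (x - b)⟫‖ ≤ C / (L - R₀) * ‖θ (x - b)‖ := by
    intro x
    by_cases hx : θ (x - b) = 0
    · simp [hx]
    · have hmem : x - b ∈ Metric.closedBall (0 : EuclideanSpace ℝ (Fin 3)) R₀ := hR₀ (subset_tsupport _ hx)
      rw [mem_closedBall_zero_iff] at hmem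
      have hr : L - R₀ ≤ cylRadius x := by
        have h := cylRadius_le_cylRadius_add_norm_sub x b
        rw [hcb, norm_sub_rev] at h
        linarith
      have hrpos : 0 < cylRadius x := hLR.trans_le hr
      have hux : ‖u t x‖ ≤ C / (L - R₀) := by
        have h1 : ‖u t x‖ ≤ C / cylRadius x := by
          rw [le_div_iff₀ hrpos, mul_comm]
          exact hC t ht x
        exact h1.trans (div_le_div_of_nonneg_left hC0 hLR hr)
      exact (norm_inner_le_norm _ _).trans (mul_le_mul_of_nonneg_right hux (norm_nonneg _))
  rw [Real.dist_eq, hsplit]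
  calc |∫ x, ⟪u t x, θ (x - b)⟫| ≤ ∫ x, ‖⟪u t x, θ (x - b)⟫‖ := by
        rw [← Real.norm_eq_abs]
        exact norm_integral_le_integral_norm _
    _ ≤ ∫ x, C / (L - R₀) * ‖θ (x - b)‖ :=
        integral_mono_of_nonneg (Eventually.of_forall fun _ => norm_nonneg _)
          (hθbi.norm.const_mul _) (Eventually.of_forall hpt)
    _ = C / (L - R₀) * N := by
        rw [integral_const_mul, hN_def]
        congr 1
        exact integral_sub_right_eq_self (fun x => ‖θ x‖) b
    _ = C * N / (L - R₀) := by ring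
    _ < ε := hsmall

end WeakStarR3

end Literature.Analysis.FluidPDE
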